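import Summits.QuantumFields.BalabanUV.Beta.EriceRemainderEnclosureHistoryAutonomyComparisonDualDiminishing

/-!
# EriceRemainderEnclosureHistoryAutonomyComparisonDualDiminishingConcaveLinear — (E137e) **THE NON-SEPARABLE CLASS `β₀ + Σ_i g_i(Σ_k c_{ik} u_k)` HAS DIMINISHING
# RETURNS: comparison for every isotone excess over it.**  (E137d) `le_of_isotone_excess_dr` compares every isotone excess over a memory of finite range that is, on the
# closed box, isotone, with diminishing returns and coordinatewise concave (hypotheses stated with coordinate updates).  THIS FILE shows the hypotheses are inhabited
# by genuinely NON-SEPARABLE memories and states the resulting comparison theorem for them: `B u = β₀ + Σ_{i<I} g_i(Σ_{k<K} c_{ik} u_k)` with `c ≥ 0` and every profile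
# `g_i` non-decreasing, concave (chord form) and Lipschitz on `[0,∞)`, floor `β₀ + Σ_i g_i(0) > 0` — e.g. `β₀ + L√(u_0 + u_3)`, `β₀ + L·min(u_1 + 2u_4, c₀)`,
# `β₀ + L·log(1 + Σ_k c_k u_k)`, the affine memory of (E135b), every separable memory with profiles concave on `[0,γ]`.  §1 the linear forms under a coordinate update
# (`linform_update`: `s_i(u|_{k↦x}) = Σ_{k′≠k} c_{ik′}u_{k′} + [k<K]c_{ik}x`); §2 **`concave_linear_structure`** (finite range, isotone, diminishing returns = equal-length chords
# of a concave profile decrease to the right (`chord_shift_le`) at the larger off-coordinate part, coordinatewise concavity = the profile's chord inequality scaled by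
# `c_{ik}`) and `concave_linear_modulus` (zeroth moment `Σ_i G_i Σ_k c_{ik}`); §3 **`le_of_isotone_excess_concave_linear`**.

Cell `pub-balaban`, β-function sub-cell, BINDER row D4 «RemainderConst leaves for Bałaban's split» (`HOME/BINDER-OWNERS.md`; owner lineage `b2b-balaban-beta-an4`;
this file by co-owner #2 lineage `b2b-balaban-beta-d4-p2`, generation 105), β-FLOW TEAM duty (1), FREEZE (0) honoured (def-free; imports (E137d) and uses its
`le_of_isotone_excess_dr` BY NAME; nothing restated).

HONEST FRAMING (page 1, verbatim and binding).  *"Discharging BetaPertH makes Bałaban's UV stability UNCONDITIONAL — a real constructive-QFT result; it is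
NOT the continuum limit and NOT the Clay problem."*  THIS FILE DISCHARGES NOTHING OF THE KIND.  Elementary real analysis about ABSTRACT functionals on a box
]0,γ]^ℕ with displayed profiles — hypotheses of a census, not facts; the form, signs, ages, moments and convexity of Bałaban's (1.22) limit functional are NOT PRINTED
([I] p. 298; GAPS G-t4-U2-1∕-2) and NOT asserted.  Row D4 class UNCHANGED (critical-path width 0; instance 0∕1; D4 DISCHARGE NO DATE).  NOT B12 Thm 2, NOT BetaPertH,
NOT continuum, NOT Clay.

WHAT IS PROVED ([folklore]; 0 `def`, 0 sorry).  §1 `linform_update`, `linform_off_nonneg`, `linform_off_mono`, `linform_nonneg_mono`.  §2 `chord_shift_le`,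
**`concave_linear_structure`**, `concave_linear_modulus`.  §3 **`le_of_isotone_excess_concave_linear`**.
-/

noncomputable section
open Finset Set

namespace Summit.QuantumFields.BalabanUV.Beta.EriceRemainderEnclosureHistoryAutonomyComparisonDualDiminishingConcaveLinear

open Literature.MathematicalPhysics.QuantumFieldTheory.Balaban1983to89
open Literature.MathematicalPhysics.QuantumFieldTheory.Balaban1983to89.T4BetaStationary
open Literature.MathematicalPhysics.QuantumFieldTheory.Balaban1983to89.T4BetaFlowWellPosed
open Summit.QuantumFields.BalabanUV.Beta.EriceRemainderEnclosureHistoryAutonomyComparisonDualDiminishing (le_of_isotone_excess_dr)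

variable {I K : ℕ} {β₀ γ : ℝ} {g : ℕ → ℝ → ℝ} {c : ℕ → ℕ → ℝ} {G : ℕ → ℝ}

/-! ## §1 The non-negative linear forms `s_i(u) = Σ_{k<K} c_{ik} u_k` -/

/-- A coordinate update moves a linear form affinely: `s(u|_{k↦x}) = Σ_{k′<K, k′≠k} c_{k′} u_{k′} + [k<K]·c_k·x`. [folklore] -/
theorem linform_update (cf w : ℕ → ℝ) (K k : ℕ) (x : ℝ) :
    ∑ k' ∈ range K, cf k' * Function.update w k x k' = (∑ k' ∈ range K \ {k}, cf k' * w k') + (if k < K then cf k else 0) * x := by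
  have e : ∀ k', cf k' * Function.update w k x k' = Function.update (fun k' => cf k' * w k') k (cf k * x) k' := by
    intro k'
    rcases eq_or_ne k' k with rfl | hne
    · simp
    · simp [hne]
  rw [sum_congr rfl fun k' _ => e k']
  by_cases hk : k < K
  · rw [sum_update_of_mem (mem_range.mpr hk)]; simp [hk]; ring
  · rw [sum_update_of_notMem (by simpa using hk), sdiff_singleton_eq_erase, erase_eq_of_notMem (by simpa using hk)]; simp [hk]

/-- The off-coordinate part of a non-negative linear form is non-negative on the closed box … [folklore] -/
theorem linform_off_nonneg {cf w : ℕ → ℝ} (hcf : ∀ k, 0 ≤ cf k) (hw : ∀ j, 0 ≤ w j ∧ w j ≤ γ) (K k : ℕ) :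
    0 ≤ ∑ k' ∈ range K \ {k}, cf k' * w k' :=
  sum_nonneg fun k' _ => mul_nonneg (hcf k') (hw k').1

/-- … and monotone in the configuration. [folklore] -/
theorem linform_off_mono {cf u v : ℕ → ℝ} (hcf : ∀ k, 0 ≤ cf k) (huv : ∀ j, u j ≤ v j) (K k : ℕ) :
    ∑ k' ∈ range K \ {k}, cf k' * u k' ≤ ∑ k' ∈ range K \ {k}, cf k' * v k' :=
  sum_le_sum fun k' _ => mul_le_mul_of_nonneg_left (huv k') (hcf k')

/-- A non-negative linear form is non-negative and monotone on the closed box. [folklore] -/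
theorem linform_nonneg_mono {cf u v : ℕ → ℝ} (hcf : ∀ k, 0 ≤ cf k) (hu : ∀ j, 0 ≤ u j ∧ u j ≤ γ) (huv : ∀ j, u j ≤ v j) (K : ℕ) :
    0 ≤ ∑ k ∈ range K, cf k * u k ∧ ∑ k ∈ range K, cf k * u k ≤ ∑ k ∈ range K, cf k * v k :=
  ⟨sum_nonneg fun k _ => mul_nonneg (hcf k) (hu k).1, sum_le_sum fun k _ => mul_le_mul_of_nonneg_left (huv k) (hcf k)⟩

/-! ## §2 `β₀ + Σ_i g_i(Σ_k c_{ik} u_k)` has finite range, is isotone, has diminishing returns, is coordinatewise concave, has a zeroth moment -/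

/-- EQUAL-LENGTH CHORDS OF A CONCAVE PROFILE DECREASE TO THE RIGHT: for `0 ≤ α ≤ β` and `0 ≤ δ₁ ≤ δ₂`,
`g(β + δ₂) − g(β + δ₁) ≤ g(α + δ₂) − g(α + δ₁)`. [folklore] -/
theorem chord_shift_le {f : ℝ → ℝ}
    (hconc : ∀ a c d e : ℝ, 0 ≤ a → a < c → 0 ≤ d → d < e → a ≤ d → c ≤ e → (f e - f d) * (c - a) ≤ (f c - f a) * (e - d))
    {α β δ₁ δ₂ : ℝ} (hα : 0 ≤ α) (hαβ : α ≤ β) (hδ₁ : 0 ≤ δ₁) (hδ : δ₁ ≤ δ₂) :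
    f (β + δ₂) - f (β + δ₁) ≤ f (α + δ₂) - f (α + δ₁) := by
  rcases hδ.eq_or_lt with heq | hlt
  · rw [heq]; simp
  · have h := hconc (α + δ₁) (α + δ₂) (β + δ₁) (β + δ₂) (by linarith) (by linarith) (by linarith) (by linarith) (by linarith) (by linarith)
    have hpos : 0 < δ₂ - δ₁ := by linarith
    have e1 : α + δ₂ - (α + δ₁) = δ₂ - δ₁ := by ring
    have e2 : β + δ₂ - (β + δ₁) = δ₂ - δ₁ := by ring
    rw [e1, e2] at h
    exact le_of_mul_le_mul_right h hpos

/-- **THE STRUCTURAL HYPOTHESES OF (E137d) FOR `B u = β₀ + Σ_{i<I} g_i(Σ_{k<K} c_{ik} u_k)`** (`c ≥ 0`; each `g_i` non-decreasing and concave on `[0,∞)` in chord form):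
finite range `K`; on the closed box: isotone, diminishing returns, coordinatewise concave. [folklore] -/
theorem concave_linear_structure {B : (ℕ → ℝ) → ℝ} (hBg : ∀ u, B u = β₀ + ∑ i ∈ range I, g i (∑ k ∈ range K, c i k * u k))
    (hc : ∀ i k, 0 ≤ c i k) (hgmono : ∀ i s t, 0 ≤ s → s ≤ t → g i s ≤ g i t)
    (hgconc : ∀ i a c' d e, 0 ≤ a → a < c' → 0 ≤ d → d < e → a ≤ d → c' ≤ e → (g i e - g i d) * (c' - a) ≤ (g i c' - g i a) * (e - d)) :
    (∀ u v : ℕ → ℝ, (∀ j, j < K → u j = v j) → B u = B v)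
    ∧ (∀ u v : ℕ → ℝ, (∀ j, 0 ≤ u j ∧ u j ≤ γ) → (∀ j, 0 ≤ v j ∧ v j ≤ γ) → (∀ j, u j ≤ v j) → B u ≤ B v)
    ∧ (∀ u v : ℕ → ℝ, (∀ j, 0 ≤ u j ∧ u j ≤ γ) → (∀ j, 0 ≤ v j ∧ v j ≤ γ) → (∀ j, u j ≤ v j) → ∀ (k : ℕ) (a c' : ℝ), 0 ≤ a → a ≤ c' → c' ≤ γ →
        B (Function.update v k c') - B (Function.update v k a) ≤ B (Function.update u k c') - B (Function.update u k a))
    ∧ (∀ u : ℕ → ℝ, (∀ j, 0 ≤ u j ∧ u j ≤ γ) → ∀ (k : ℕ) (a c' d e : ℝ), 0 ≤ a → a < c' → 0 ≤ d → d < e → a ≤ d → c' ≤ e → e ≤ γ →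
        (B (Function.update u k e) - B (Function.update u k d)) * (c' - a) ≤ (B (Function.update u k c') - B (Function.update u k a)) * (e - d)) := by
  refine ⟨?_, ?_, ?_, ?_⟩
  · -- finite range
    intro u v huv
    rw [hBg u, hBg v]
    congr 1
    refine sum_congr rfl fun i _ => ?_
    congr 1
    exact sum_congr rfl fun k hk => by rw [huv k (mem_range.mp hk)]
  · -- isotone
    intro u v hu hv hle
    rw [hBg u, hBg v]
    refine add_le_add le_rfl (sum_le_sum fun i _ => ?_)
    obtain ⟨h0, hm⟩ := linform_nonneg_mono (hc i) hu hle K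
    exact hgmono i _ _ h0 hm
  · -- diminishing returns
    intro u v hu hv hle k a c' ha hac _
    rw [hBg, hBg, hBg, hBg]
    have e : ∀ (w : ℕ → ℝ) (x : ℝ) (i : ℕ), ∑ k' ∈ range K, c i k' * Function.update w k x k'
        = (∑ k' ∈ range K \ {k}, c i k' * w k') + (if k < K then c i k else 0) * x := fun w x i => linform_update (c i) w K k x
    simp only [e]
    have hck : ∀ i, 0 ≤ (if k < K then c i k else 0) := fun i => by split_ifs <;> simp [hc i k]
    have : ∀ i ∈ range I, g i ((∑ k' ∈ range K \ {k}, c i k' * v k') + (if k < K then c i k else 0) * c')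
          - g i ((∑ k' ∈ range K \ {k}, c i k' * v k') + (if k < K then c i k else 0) * a)
        ≤ g i ((∑ k' ∈ range K \ {k}, c i k' * u k') + (if k < K then c i k else 0) * c')
          - g i ((∑ k' ∈ range K \ {k}, c i k' * u k') + (if k < K then c i k else 0) * a) := by
      intro i _
      exact chord_shift_le (hgconc i) (linform_off_nonneg (hc i) hu K k) (linform_off_mono (hc i) hle K k)
        (mul_nonneg (hck i) ha) (mul_le_mul_of_nonneg_left hac (hck i))
    have hs := sum_le_sum this
    rw [sum_sub_distrib, sum_sub_distrib] at hs
    linarith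
  · -- coordinatewise concave
    intro u hu k a c' d e ha hac hd hde had hce _
    rw [hBg, hBg, hBg, hBg]
    have eq : ∀ (x : ℝ) (i : ℕ), ∑ k' ∈ range K, c i k' * Function.update u k x k'
        = (∑ k' ∈ range K \ {k}, c i k' * u k') + (if k < K then c i k else 0) * x := fun x i => linform_update (c i) u K k x
    simp only [eq]
    have hck : ∀ i, 0 ≤ (if k < K then c i k else 0) := fun i => by split_ifs <;> simp [hc i k]
    have : ∀ i ∈ range I,
        (g i ((∑ k' ∈ range K \ {k}, c i k' * u k') + (if k < K then c i k else 0) * e)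
          - g i ((∑ k' ∈ range K \ {k}, c i k' * u k') + (if k < K then c i k else 0) * d)) * (c' - a)
        ≤ (g i ((∑ k' ∈ range K \ {k}, c i k' * u k') + (if k < K then c i k else 0) * c')
          - g i ((∑ k' ∈ range K \ {k}, c i k' * u k') + (if k < K then c i k else 0) * a)) * (e - d) := by
      intro i _
      set b : ℝ := ∑ k' ∈ range K \ {k}, c i k' * u k' with hb
      set q : ℝ := (if k < K then c i k else 0) with hq
      have hb0 : 0 ≤ b := linform_off_nonneg (hc i) hu K k
      rcases (hck i).eq_or_lt with hq0 | hqpos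
      · have hq0' : q = 0 := by rw [hq]; exact hq0.symm
        rw [hq0']; simp
      · have h := hgconc i (b + q * a) (b + q * c') (b + q * d) (b + q * e) (by positivity) (by nlinarith) (by positivity) (by nlinarith)
          (by nlinarith) (by nlinarith)
        have e1 : b + q * c' - (b + q * a) = q * (c' - a) := by ring
        have e2 : b + q * e - (b + q * d) = q * (e - d) := by ring
        rw [e1, e2] at h
        -- divide by q > 0
        have h' : q * ((g i (b + q * e) - g i (b + q * d)) * (c' - a)) ≤ q * ((g i (b + q * c') - g i (b + q * a)) * (e - d)) := by
          nlinarith [h]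
        exact le_of_mul_le_mul_left h' hqpos
    have hs := sum_le_sum this
    rw [← sum_mul, ← sum_mul, sum_sub_distrib, sum_sub_distrib] at hs
    nlinarith [hs]

/-- **A ZEROTH MOMENT FOR `β₀ + Σ_i g_i(Σ_k c_{ik} u_k)`**: if each `g_i` is `G_i`-Lipschitz on `[0,∞)` then on the closed box
`|B u − B u′| ≤ (Σ_i G_i Σ_k c_{ik})·D` whenever `|u_j − u′_j| ≤ D`. [folklore] -/
theorem concave_linear_modulus {B : (ℕ → ℝ) → ℝ} (hBg : ∀ u, B u = β₀ + ∑ i ∈ range I, g i (∑ k ∈ range K, c i k * u k))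
    (hc : ∀ i k, 0 ≤ c i k) (hgLip : ∀ i s t, 0 ≤ s → 0 ≤ t → |g i s - g i t| ≤ G i * |s - t|) (hG : ∀ i, 0 ≤ G i) :
    ∀ u u' : ℕ → ℝ, SeqBox γ u → SeqBox γ u' → ∀ D : ℝ, (∀ j, |u j - u' j| ≤ D) →
      |B u - B u'| ≤ (∑ i ∈ range I, G i * ∑ k ∈ range K, c i k) * D := by
  intro u u' hu hu' D hD
  rw [hBg u, hBg u', add_sub_add_left_eq_sub, ← sum_sub_distrib, sum_mul]
  refine (abs_sum_le_sum_abs _ _).trans (sum_le_sum fun i _ => ?_)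
  have hs0 : 0 ≤ ∑ k ∈ range K, c i k * u k := sum_nonneg fun k _ => mul_nonneg (hc i k) (hu k).1.le
  have hs0' : 0 ≤ ∑ k ∈ range K, c i k * u' k := sum_nonneg fun k _ => mul_nonneg (hc i k) (hu' k).1.le
  refine (hgLip i _ _ hs0 hs0').trans ?_
  rw [← sum_sub_distrib, mul_assoc]
  refine mul_le_mul_of_nonneg_left ?_ (hG i)
  rw [sum_mul]
  refine (abs_sum_le_sum_abs _ _).trans (sum_le_sum fun k _ => ?_)
  rw [← mul_sub, abs_mul, abs_of_nonneg (hc i k)]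
  exact mul_le_mul_of_nonneg_left (hD k) (hc i k)

/-! ## §3 Comparison for the non-separable class `β₀ + Σ_i g_i(Σ_k c_{ik} u_k)` -/

/-- **COMPARISON FOR EVERY ISOTONE EXCESS OVER `β₀ + Σ_{i<I} g_i(Σ_{k<K} c_{ik} u_k)`** — a NON-SEPARABLE instance of (E137d) `le_of_isotone_excess_dr`: `c ≥ 0`; each
profile `g_i` non-decreasing, concave (chord form) and `G_i`-Lipschitz on `[0,∞)`; floor `β₀ + Σ_i g_i(0) > 0`; `B′ ≥ B` on the box ]0,γ] with a zeroth moment and ISOTONE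
excess; `h`, `h′` ANY box solutions of `B`, `B′` from one pin.  Then `h′ ≤ h` at every scale.  Examples: `β₀ + L·√(u_0 + u_3)`, `β₀ + L·min(u_1 + 2u_4, c₀)`,
`β₀ + L·log(1 + Σ_k c_k u_k)`, the affine memory, every separable memory with profiles concave on `[0,γ]`. [folklore] -/
theorem le_of_isotone_excess_concave_linear {B B' : (ℕ → ℝ) → ℝ} {M' p : ℝ} {h h' : ℕ → ℝ}
    (hBg : ∀ u, B u = β₀ + ∑ i ∈ range I, g i (∑ k ∈ range K, c i k * u k))
    (hc : ∀ i k, 0 ≤ c i k) (hgmono : ∀ i s t, 0 ≤ s → s ≤ t → g i s ≤ g i t)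
    (hgconc : ∀ i a c' d e, 0 ≤ a → a < c' → 0 ≤ d → d < e → a ≤ d → c' ≤ e → (g i e - g i d) * (c' - a) ≤ (g i c' - g i a) * (e - d))
    (hgLip : ∀ i s t, 0 ≤ s → 0 ≤ t → |g i s - g i t| ≤ G i * |s - t|) (hG : ∀ i, 0 ≤ G i)
    (hfloor : 0 < β₀ + ∑ i ∈ range I, g i 0)
    (hB' : ∀ u u' : ℕ → ℝ, SeqBox γ u → SeqBox γ u' → ∀ D : ℝ, (∀ j, |u j - u' j| ≤ D) → |B' u - B' u'| ≤ M' * D) (hM' : 0 ≤ M')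
    (hexc : ∀ u, SeqBox γ u → B u ≤ B' u)
    (hDmono : ∀ u v : ℕ → ℝ, SeqBox γ u → SeqBox γ v → (∀ j, u j ≤ v j) → B' u - B u ≤ B' v - B v)
    (hp : 0 < p) (hpγ : p ≤ γ) (hh : SeqBox γ h) (hf : MemFlow B p h) (hh' : SeqBox γ h') (hf' : MemFlow B' p h') (j : ℕ) :
    h' j ≤ h j := by
  obtain ⟨hK, hmonoC, hDR, hconc⟩ := concave_linear_structure (γ := γ) hBg hc hgmono hgconc
  have hB0 : 0 < B (fun _ => 0) := by rw [hBg]; simpa using hfloor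
  have hM : 0 ≤ ∑ i ∈ range I, G i * ∑ k ∈ range K, c i k := sum_nonneg fun i _ => mul_nonneg (hG i) (sum_nonneg fun k _ => hc i k)
  exact le_of_isotone_excess_dr hK hmonoC hDR hconc hB0 (concave_linear_modulus hBg hc hgLip hG) hM hB' hM' hexc hDmono hp hpγ hh hf hh' hf' j

end Summit.QuantumFields.BalabanUV.Beta.EriceRemainderEnclosureHistoryAutonomyComparisonDualDiminishingConcaveLinear

end
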